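import Literature.RingTheory.MvPowerSeries.ConvergentRename
import Mathlib.RingTheory.Noetherian.Basic
import Mathlib.RingTheory.Finiteness.Ideal
import Mathlib.Data.Fintype.Option
import Mathlib.RingTheory.PrincipalIdealDomain
import Mathlib.Algebra.EuclideanDomain.Field
import HarnessLib

/-!
# The Rückert basis theorem: `𝕜{x₁, …, xₙ}` is Noetherian

Topic `Literature/RingTheory/MvPowerSeries`.  For a complete normed field `𝕜` with infinitely
many elements (e.g. `ℝ`, `ℂ`), the ring `convergent σ 𝕜 = 𝕜{x}` of convergent power series in
finitely many variables is Noetherian (`convergent.isNoetherianRing`; W. Rückert 1933;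
H. Grauert, R. Remmert, *Analytische Stellenalgebren* (1971), Kap. I §5, Satz 2 (Rückertscher
Basissatz); J. M. Ruiz, *The basic theory of power series* (1993), Thm. 3.2).

The proof is the classical induction on the number of variables (`Fintype.induction_empty_option`):
an ideal `I ⊆ 𝕜{T, x'}` containing an element `g` regular in `T` of order `d` is finitely
generated (`Ideal.fg_of_mem_isTRegular`), because Weierstrass division (`weierstrass_division`,
file `WeierstrassDivision.lean`) writes every `f ∈ I` as `q g + r` with `r` in the finitely
generated `𝕜{x'}`-module `M = ⊕_{k<d} 𝕜{x'} T^k`, and `I ∩ M` is finitely generated over the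
Noetherian ring `𝕜{x'}`; a general non-zero ideal acquires a regular element after a shear
automorphism (`exists_shear_isTRegular`, file `ConvergentRename.lean`).

Everything is proved; no named facts.

## References

* H. Grauert, R. Remmert, *Analytische Stellenalgebren*, Springer (1971), Kap. I §5 Satz 2.
  [GrauertRemmert1971]
* J. M. Ruiz, *The basic theory of power series*, Vieweg (1993), Thm. 3.2. [Ruiz1993]
* J. Denef, L. van den Dries, *p-adic and real subanalytic sets*, Ann. of Math. 128 (1988), §4
  ("`ℝ{X}` is noetherian"). [DenefvandenDries1988]
-/

noncomputable section

open MvPowerSeries Finsupp Filter Function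
open scoped NNReal ENNReal Topology BigOperators

namespace Literature.RingTheory.MvPowerSeries

universe u

variable {σ : Type*} {𝕜 : Type*} [NormedField 𝕜]

/-! ### 1. `T`-slices of a series and the reconstruction of `T`-polynomials -/

section Slices

/-- The `T^k`-slice of `F ∈ 𝕜⟦T, x'⟧`: the series in `x'` with `[x'^β] = [T^k x'^β] F`.
[cite: GrauertRemmert1971, Kap. I §4] -/
def sliceT (k : ℕ) (F : MvPowerSeries (Option σ) 𝕜) : MvPowerSeries σ 𝕜 :=
  fun β => coeff (β.optionElim k) F

/-- Coefficients of `sliceT`. [folklore] -/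
@[simp] theorem coeff_sliceT (k : ℕ) (F : MvPowerSeries (Option σ) 𝕜) (β : σ →₀ ℕ) :
    coeff β (sliceT k F) = coeff (β.optionElim k) F := rfl

/-- Weights of `β.optionElim k`: `ρ^{(k, β)} = ρ_T^k (ρ ∘ some)^β`. [folklore] -/
theorem wt_optionElim (ρ : Option σ → ℝ≥0) (k : ℕ) (β : σ →₀ ℕ) :
    wt ρ (β.optionElim k) = ρ none ^ k * wt (ρ ∘ some) β := by
  classical
  unfold wt
  rw [Finsupp.prod_option_index _ _ (fun o => pow_zero _) (fun o m₁ m₂ => pow_add _ _ _),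
    Finsupp.optionElim_apply_none, Finsupp.some_optionElim]
  rfl

/-- **Slices are dominated**: `‖sliceT k F‖_{ρ∘some} · ρ_T^k ≤ ‖F‖_ρ`. [folklore] -/
theorem wnorm_sliceT_mul_le (ρ : Option σ → ℝ≥0) (k : ℕ) (F : MvPowerSeries (Option σ) 𝕜) :
    wnorm (ρ ∘ some) (sliceT k F) * (ρ none : ℝ≥0∞) ^ k ≤ wnorm ρ F := by
  unfold wnorm
  rw [← ENNReal.tsum_mul_right]
  calc ∑' β, ((‖coeff β (sliceT k F)‖₊ * wt (ρ ∘ some) β : ℝ≥0) : ℝ≥0∞) * (ρ none : ℝ≥0∞) ^ k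
      = ∑' β : σ →₀ ℕ, ((‖coeff (β.optionElim k) F‖₊ * wt ρ (β.optionElim k) : ℝ≥0) : ℝ≥0∞) := by
        refine tsum_congr fun β => ?_
        rw [coeff_sliceT, wt_optionElim, ← ENNReal.coe_pow, ← ENNReal.coe_mul]
        push_cast; ring
    _ ≤ ∑' e, ((‖coeff e F‖₊ * wt ρ e : ℝ≥0) : ℝ≥0∞) :=
        ENNReal.tsum_comp_le_tsum_of_injective (fun β β' h => by
          simpa using congrArg Finsupp.some h) _

/-- Slices of convergent series are convergent. [folklore] -/
theorem HasPosRadius.sliceT (k : ℕ) {F : MvPowerSeries (Option σ) 𝕜} (hF : HasPosRadius F) :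
    HasPosRadius (sliceT k F) := by
  obtain ⟨ρ, hρ, hfin⟩ := hF
  refine ⟨ρ ∘ some, fun i => hρ _, ?_⟩
  have h := wnorm_sliceT_mul_le ρ k F
  have hk : (ρ none : ℝ≥0∞) ^ k ≠ 0 := pow_ne_zero _ (ENNReal.coe_ne_zero.mpr (hρ none).ne')
  refine lt_of_le_of_lt ?_ (ENNReal.div_lt_top hfin.ne hk)
  rw [ENNReal.le_div_iff_mul_le (Or.inl hk) (Or.inl (ENNReal.pow_ne_top ENNReal.coe_ne_top))]
  exact h

/-- Coefficients of `(rename some G) · T^k`. [folklore] -/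
theorem coeff_rename_some_mul_X_pow (G : MvPowerSeries σ 𝕜) (k : ℕ) (e : Option σ →₀ ℕ) :
    coeff e (rename (Function.Embedding.some : σ ↪ Option σ) G * (X none : MvPowerSeries (Option σ) 𝕜) ^ k) =
      if e none = k then coeff e.some G else 0 := by
  rw [X_pow_eq, coeff_mul_monomial, mul_one]
  by_cases hk : k ≤ e none
  · rw [if_pos (Finsupp.single_le_iff.mpr hk), coeff_rename_some]
    have h1 : (e - single (none : Option σ) k : Option σ →₀ ℕ) none = e none - k := by simp
    have h2 : (e - single (none : Option σ) k : Option σ →₀ ℕ).some = e.some := by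
      ext s; simp
    rw [h1, h2]
    by_cases he : e none = k
    · rw [if_pos (by omega), if_pos he]
    · rw [if_neg (by omega), if_neg he]
  · rw [if_neg (fun h => hk (Finsupp.single_le_iff.mp h)), if_neg (by omega)]

/-- **Reconstruction of a `T`-polynomial from its slices**:
`r = ∑_{k<d} (sliceT k r)(x') T^k` when `r` has `T`-degree `< d`. [folklore] -/
theorem eq_sum_sliceT_of_isTPoly {d : ℕ} {r : MvPowerSeries (Option σ) 𝕜} (hr : IsTPoly d r) :
    r = ∑ k ∈ Finset.range d,
      rename (Function.Embedding.some : σ ↪ Option σ) (sliceT k r) * (X none : MvPowerSeries (Option σ) 𝕜) ^ k := by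
  ext e
  rw [map_sum]
  simp_rw [coeff_rename_some_mul_X_pow, coeff_sliceT]
  rw [Finset.sum_ite_eq (Finset.range d) (e none) (fun k => coeff (e.some.optionElim k) r)]
  by_cases he : e none < d
  · rw [if_pos (Finset.mem_range.mpr he), Finsupp.optionElim_some]
  · rw [if_neg (fun h => he (Finset.mem_range.mp h)), hr e (not_lt.mp he)]

end Slices

/-! ### 2. Ideals with a regular element are finitely generated -/

section RegularIdeal

variable [CompleteSpace 𝕜]

/-- **An ideal of `𝕜{T, x'}` containing a `T`-regular element is finitely generated, provided
`𝕜{x'}` is Noetherian** (the Weierstrass-division step of the Rückert basis theorem).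
[cite: GrauertRemmert1971, Kap. I §5 Satz 2] -/
theorem Ideal.fg_of_mem_isTRegular [IsNoetherianRing (convergent σ 𝕜)]
    (I : Ideal (convergent (Option σ) 𝕜)) {g : convergent (Option σ) 𝕜} {d : ℕ}
    (hgI : g ∈ I) (hreg : IsTRegular d (g : MvPowerSeries (Option σ) 𝕜)) : I.FG := by
  classical
  -- `𝕜{T, x'}` as an algebra over `𝕜{x'}` through `rename some`
  letI : Algebra (convergent σ 𝕜) (convergent (Option σ) 𝕜) :=
    (convergentOptionEmb σ 𝕜).toRingHom.toAlgebra
  have hsmul : ∀ (a : convergent σ 𝕜) (s : convergent (Option σ) 𝕜),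
      a • s = convergentOptionEmb σ 𝕜 a * s := fun a s => rfl
  -- the `𝕜{x'}`-module `M` spanned by `1, T, …, T^{d-1}`
  set Tpow : ℕ → convergent (Option σ) 𝕜 :=
    fun k => ⟨(X none : MvPowerSeries (Option σ) 𝕜) ^ k, (HasPosRadius.X none).pow k⟩ with hTpow
  set M : Submodule (convergent σ 𝕜) (convergent (Option σ) 𝕜) :=
    Submodule.span (convergent σ 𝕜) ((Finset.range d).image Tpow : Set (convergent (Option σ) 𝕜)) with hM
  have hMfg : M.FG := ⟨(Finset.range d).image Tpow, rfl⟩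
  -- `N = I ∩ M` is finitely generated over `𝕜{x'}`
  set N : Submodule (convergent σ 𝕜) (convergent (Option σ) 𝕜) :=
    (I.restrictScalars (convergent σ 𝕜)) ⊓ M with hN
  have hNfg : N.FG := by
    haveI : IsNoetherian (convergent σ 𝕜) M := isNoetherian_of_fg_of_noetherian M hMfg
    have h1 : (Submodule.comap M.subtype (I.restrictScalars (convergent σ 𝕜))).FG :=
      IsNoetherian.noetherian _
    have h2 := h1.map M.subtype
    rwa [Submodule.map_comap_subtype, inf_comm] at h2
  obtain ⟨T, hT⟩ := hNfg
  -- claim: `I = span ({g} ∪ T)`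
  refine ⟨insert g T, le_antisymm ?_ ?_⟩
  · rw [Ideal.span_le]
    intro x hx
    change x ∈ I
    rcases Finset.mem_insert.mp hx with h | hx
    · rw [h]; exact hgI
    · have hxN : x ∈ N := hT ▸ Submodule.subset_span hx
      exact (Submodule.restrictScalars_mem (convergent σ 𝕜) I x).mp hxN.1
  · intro f hfI
    -- Weierstrass division `f = q g + r`
    obtain ⟨q, r, hq, hr, hpoly, hdiv⟩ := exists_weierstrass_division g.2 hreg f.2
    set q' : convergent (Option σ) 𝕜 := ⟨q, hq⟩
    set r' : convergent (Option σ) 𝕜 := ⟨r, hr⟩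
    have hfqr : f = q' * g + r' := Subtype.ext hdiv
    have hrI : r' ∈ I := by
      have : r' = f - q' * g := by rw [hfqr]; ring
      rw [this]
      exact I.sub_mem hfI (I.mul_mem_left _ hgI)
    -- `r' ∈ M` by the slice reconstruction
    have hrM : r' ∈ M := by
      have hrec := eq_sum_sliceT_of_isTPoly hpoly
      have : r' = ∑ k ∈ Finset.range d,
          (⟨sliceT k r, hr.sliceT k⟩ : convergent σ 𝕜) • Tpow k := by
        apply Subtype.ext
        change r = _
        conv_lhs => rw [hrec]
        push_cast
        refine Finset.sum_congr rfl fun k _ => ?_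
        rw [hsmul]; rfl
      rw [this]
      refine Submodule.sum_mem _ fun k hk => Submodule.smul_mem _ _ (Submodule.subset_span ?_)
      exact Finset.mem_image_of_mem Tpow hk
    have hrN : r' ∈ N := ⟨hrI, hrM⟩
    rw [← hT] at hrN
    -- `𝕜{x'}`-span ⊆ `𝕜{T,x'}`-span
    have hrspan : r' ∈ Ideal.span (T : Set (convergent (Option σ) 𝕜)) :=
      Submodule.span_le_restrictScalars (convergent σ 𝕜) (convergent (Option σ) 𝕜)
        (T : Set (convergent (Option σ) 𝕜)) hrN
    rw [hfqr, Finset.coe_insert]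
    refine Ideal.add_mem _ (Ideal.mul_mem_left _ _ (Ideal.subset_span (Set.mem_insert _ _))) ?_
    exact Ideal.span_mono (Set.subset_insert _ _) hrspan

end RegularIdeal

section ShearEquiv

/-- **The shear automorphism of `𝕜{T, x'}`** as an algebra equivalence of the convergent
subalgebra. [cite: GrauertRemmert1971, Kap. I §4] -/
def shearEquiv [Finite σ] (c : σ → 𝕜) : convergent (Option σ) 𝕜 ≃ₐ[𝕜] convergent (Option σ) 𝕜 where
  toFun f := ⟨shear c f, HasPosRadius.shear c f.2⟩
  invFun f := ⟨shear (-c) f, HasPosRadius.shear (-c) f.2⟩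
  left_inv f := Subtype.ext (shear_neg_shear c f)
  right_inv f := Subtype.ext (by
    change shear c (shear (-c) (f : MvPowerSeries (Option σ) 𝕜)) = f
    have := shear_neg_shear (-c) (f : MvPowerSeries (Option σ) 𝕜)
    rwa [neg_neg] at this)
  map_mul' f g := Subtype.ext (by
    change shear c ((f : MvPowerSeries (Option σ) 𝕜) * g) = shear c f * shear c g
    rw [shear_eq_substAlgHom, shear_eq_substAlgHom, shear_eq_substAlgHom, map_mul])
  map_add' f g := Subtype.ext (by
    change shear c ((f : MvPowerSeries (Option σ) 𝕜) + g) = shear c f + shear c g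
    rw [shear_eq_substAlgHom, shear_eq_substAlgHom, shear_eq_substAlgHom, map_add])
  commutes' a := Subtype.ext (by
    change shear c (algebraMap 𝕜 (MvPowerSeries (Option σ) 𝕜) a) = algebraMap 𝕜 _ a
    rw [shear_eq_substAlgHom, AlgHom.commutes])

/-- `shearEquiv` acts by `shear`. [folklore] -/
@[simp] theorem coe_shearEquiv [Finite σ] (c : σ → 𝕜) (f : convergent (Option σ) 𝕜) :
    ((shearEquiv c f : convergent (Option σ) 𝕜) : MvPowerSeries (Option σ) 𝕜) = shear c f := rfl

end ShearEquiv

section Step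

variable [CompleteSpace 𝕜]

/-- **Induction step of the Rückert basis theorem**: if `𝕜{x'}` is Noetherian then so is
`𝕜{T, x'}` (finitely many variables, infinite complete field).
[cite: GrauertRemmert1971, Kap. I §5 Satz 2] -/
theorem isNoetherianRing_option [Finite σ] [Infinite 𝕜] [IsNoetherianRing (convergent σ 𝕜)] :
    IsNoetherianRing (convergent (Option σ) 𝕜) := by
  classical
  rw [isNoetherianRing_iff_ideal_fg]
  intro I
  by_cases hI : I = ⊥
  · rw [hI]; exact Submodule.fg_bot
  · -- a non-zero element, made regular by a shear
    obtain ⟨g, hgI, hg0⟩ := I.ne_bot_iff.mp hI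
    have hg0' : (g : MvPowerSeries (Option σ) 𝕜) ≠ 0 := fun h => hg0 (Subtype.ext h)
    obtain ⟨c, d, hreg⟩ := exists_shear_isTRegular hg0'
    let e : convergent (Option σ) 𝕜 ≃+* convergent (Option σ) 𝕜 := (shearEquiv c).toRingEquiv
    have hreg' : IsTRegular d (((e : convergent (Option σ) 𝕜 →+* convergent (Option σ) 𝕜) g :
        convergent (Option σ) 𝕜) : MvPowerSeries (Option σ) 𝕜) := hreg
    have hJ : (I.map (e : convergent (Option σ) 𝕜 →+* convergent (Option σ) 𝕜)).FG :=
      Ideal.fg_of_mem_isTRegular _ (Ideal.mem_map_of_mem _ hgI) hreg'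
    have h2 := hJ.map (e.symm : convergent (Option σ) 𝕜 →+* convergent (Option σ) 𝕜)
    rwa [Ideal.map_of_equiv (I := I) e] at h2

end Step

/-! ### 3. The Rückert basis theorem -/

section Rueckert

variable [CompleteSpace 𝕜] [Infinite 𝕜]

omit [CompleteSpace 𝕜] [Infinite 𝕜] in
/-- **No variables**: `𝕜{∅} = 𝕜` is Noetherian. [folklore] -/
theorem isNoetherianRing_pempty : IsNoetherianRing (convergent PEmpty.{u+1} 𝕜) := by
  -- `𝕜{∅}` is spanned by `1` over `𝕜`
  haveI : Module.Finite 𝕜 (convergent PEmpty.{u+1} 𝕜) := by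
    refine ⟨⟨{1}, ?_⟩⟩
    rw [Finset.coe_singleton, eq_top_iff]
    rintro f -
    have hf : (f : MvPowerSeries PEmpty 𝕜) = C (constantCoeff (f : MvPowerSeries PEmpty 𝕜)) := by
      ext d
      have hd : d = 0 := Subsingleton.elim d 0
      subst hd
      simp
    have : f = constantCoeff (f : MvPowerSeries PEmpty 𝕜) • (1 : convergent PEmpty 𝕜) := by
      apply Subtype.ext
      change (f : MvPowerSeries PEmpty 𝕜) = constantCoeff (f : MvPowerSeries PEmpty 𝕜) • (1 : MvPowerSeries PEmpty 𝕜)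
      rw [smul_eq_C_mul, mul_one]; exact hf
    rw [this]
    exact Submodule.smul_mem _ _ (Submodule.mem_span_singleton_self _)
  exact isNoetherian_of_tower 𝕜 (isNoetherian_of_isNoetherianRing_of_finite 𝕜 (convergent PEmpty.{u+1} 𝕜))

/-- **Rückert basis theorem**: the ring `𝕜{x₁, …, xₙ}` of convergent power series in finitely
many variables over an infinite complete normed field is Noetherian.
[cite: GrauertRemmert1971, Kap. I §5 Satz 2] -/
theorem convergent.isNoetherianRing (σ : Type u) [Finite σ] : IsNoetherianRing (convergent σ 𝕜) := by
  haveI := Fintype.ofFinite σ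
  refine Fintype.induction_empty_option (P := fun (α : Type u) _ => IsNoetherianRing (convergent α 𝕜))
    ?_ ?_ ?_ σ
  · intro α β _ e h
    exact isNoetherianRing_of_ringEquiv _ (convergentCongr 𝕜 e).toRingEquiv
  · exact isNoetherianRing_pempty
  · intro α _ h
    haveI := h
    exact isNoetherianRing_option

end Rueckert

end Literature.RingTheory.MvPowerSeries
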